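import Summits.QuantumFields.BalabanUV.Beta.GAN24.TransportStepLipschitz
import Summits.QuantumFields.BalabanUV.Beta.GAN24.Lin4ZeroMode
import Summits.QuantumFields.BalabanUV.Beta.GAN24.WSlotCauchyOfShapes
import Summits.QuantumFields.BalabanUV.Beta.GAN24.WSlotForcingZeroMode
import Summits.QuantumFields.BalabanUV.Beta.GAN24.WSlotForcingZeroModeW3
import Summits.QuantumFields.BalabanUV.Beta.GAN24.WSlotT2OfPieces

/-!
# `BalabanUV.Beta.GAN24.T2DevConservationDriftRows` — binder row G-an2-4 / (CONV-C), W-slot CT-W, route «WC-TL» (RULING R-gan24p1-g24-1), A-0 in DEVIATION FORM: **THE GENERIC ROWS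
# OF THE DRIFT TWIN** (this lineage's INTENT I-leaf01-g63-1, journal l.39137; consumed by `T2DevConservationDrift`): the `hZf` and `hf` slots of the OWNER gan24-p1's socket
# `T2DeviationDrift.drift_of_dev_rows` at `A := 𝒜^B` (road W3's undressed `lin4` family), for GENERIC tables — the forcing `f_m := (𝒜^B_{m+1} X_m − 𝒜^B_m X_m) + (G_{m+1} − G_m)`
# is `ZfreeSym` (from `ZfreeSym (G_m), ZfreeSym (G_{m+1})`, NO charge hypothesis on `X_m`) and geometrically `LocStencil₂` (from a uniform shape of `X_m`, road P1's K-slot rows and a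
# RATE row of `G`).

NOT IN PRINT; OUR BOOKKEEPING ([folklore] composition BY NAME: leaf-18's `Lin4ZeroMode.lin4_translate ∕ zmode_lin4_sub_lin4_step ∕ locStencil₂_lin4`, `WSlotForcingZeroModeW3.add∕sub_translate_pi`,
leaf-19's `WSlotFirstDiff.zmode_add ∕ zmode_sub`, leaf-03's `TransportStepLipschitz.lin_cauchy`, `WSlotCauchyOfShapes.locStencil₂_le_mono`; G-an2-4 formalisation swarm, leaf prover
`b2b-balaban-gan24-formalise-leaf-01`, gen 63).  HONEST FRAMING (cell contract, verbatim): «discharging `BetaPertH` makes Bałaban's UV stability UNCONDITIONAL — a real constructive-QFT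
result; it is NOT the continuum limit and NOT the Clay problem.»  HONEST DEPENDENCY (verbatim): «continuum YM on T⁴ ⇐ BetaPertH ∧ nine spine estimates (0/9 proved); BetaPertH ⇐ (D1) ∧
(D4) ∧ CAP+tail; G-an2-4 gates asym, D1 and NE2/3/4.»

* `zfreeSym_add`, `zfreeSym_sub`: the `ZfreeSym` text (joint `Lc`-covariance ∧ bond-symmetrised ff cell charge zero, road W3's currency) is closed under `±` on `LocStencil₂` tables.
* **`zfreeSym_lin4_sub_lin4`**: the transport DIFFERENCE `(𝒜^B_i − 𝒜^B_j) X` of ANY jointly covariant `LocStencil₂` table is `ZfreeSym` (the undressed eigenfunctional is `j`-FREE).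
* **`zfreeSym_forcing`**: `ZfreeSym ((𝒜^B_i X − 𝒜^B_j X) + (G′ − G))` from `ZfreeSym G, ZfreeSym G′` — the socket's `hZf` row.
* **`exists_forcing_rate`**: `∃ Cf θf δf, … ∀ m, LocStencil₂ ((𝒜^B_{m+1} X_m − 𝒜^B_m X_m) + (G_{m+1} − G_m)) (Cf·θf^m) δf` — the socket's `hf` row.
[folklore] algebra and bookkeeping on generic tables; asserts NOTHING about an2's towers; NEVER «G-an2-4 closed» as (CONV-C); NOT D1, NOT `BetaPertH`, NOT continuum, NOT Clay.
0 cited facts, 0 `def`, 0 `def … : Prop`, 0 sorry.  2026-08-22.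
-/

noncomputable section

open Finset
open scoped BigOperators
open Literature.MathematicalPhysics.QuantumFieldTheory
open Literature.MathematicalPhysics.QuantumFieldTheory.Balaban1983to89
open Literature.MathematicalPhysics.QuantumFieldTheory.Balaban1983to89.Beta
open ExpKernelCalculus (MKer Decays shiftK)
open OneStepResolventKernel (Fib LocStencil decays_mono)
open OneStepKernelFamily (KInvStep)
open SecondOrderResponse (cBi)
open BalabanCompositeJets (LocStencil₂)
open Summit.QuantumFields.BalabanUV.Beta.HessKerDressedUnits (unitK)
open Summit.QuantumFields.BalabanUV.Beta.GAN24.CombesThomas (sfStep smStep)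
open Summit.QuantumFields.BalabanUV.Beta.GAN24.T2RecursionAffine (lin4)
open Summit.QuantumFields.BalabanUV.Beta.GAN24.BiStencilZeroMode (Tab zmode)
open Summit.QuantumFields.BalabanUV.Beta.GAN24.WSlotFirstDiff (zmode_add zmode_sub)
open Summit.QuantumFields.BalabanUV.Beta.GAN24.WSlotForcingZeroMode (locStencil₂_sub)
open Summit.QuantumFields.BalabanUV.Beta.GAN24.WSlotForcingZeroModeW3 (sub_translate_pi add_translate_pi)
open Summit.QuantumFields.BalabanUV.Beta.GAN24.WSlotT2OfPieces (locStencil₂_add)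
open Summit.QuantumFields.BalabanUV.Beta.GAN24.WSlotCauchyOfShapes (locStencil₂_le_mono mul_pow_le_mul_pow)
open Summit.QuantumFields.BalabanUV.Beta.GAN24.SecondOrderLipschitz (lSand)
open Summit.QuantumFields.BalabanUV.Beta.GAN24.SecondOrderLipschitzBi (lBi)
open Summit.QuantumFields.BalabanUV.Beta.GAN24.TransportStepLipschitz (lin_cauchy)
open Summit.QuantumFields.BalabanUV.Beta.GAN24.Lin4ZeroMode (lin4_translate shiftK_unitKInvStep zmode_lin4_sub_lin4_step locStencil₂_lin4)

namespace Summit.QuantumFields.BalabanUV.Beta.GAN24.T2DevConservationDriftRows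

/-! ## §1 The `ZfreeSym` text under `±` and under the transport difference -/

section Generic

variable {d : ℕ} {Lc : ℕ} [NeZero Lc]

omit [NeZero Lc] in
/-- [folklore] **THE `ZfreeSym` TEXT IS CLOSED UNDER `+`** on `LocStencil₂` tables at a common rate `δ > 0` (leaf-18's `add_translate_pi`, leaf-19's `zmode_add`). -/
theorem zfreeSym_add {X Y : Tab d} {CX CY δ : ℝ} (hX : LocStencil₂ X CX δ) (hY : LocStencil₂ Y CY δ) (hδ : 0 < δ)
    (hZX : (∀ κ u κ' u' t, X κ (u + (Lc : ℤ) • t) κ' (u' + (Lc : ℤ) • t) = shiftK (-((Lc : ℤ) • t)) (X κ u κ' u')) ∧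
      (∀ κ κ' κ₁ κ₂, zmode Lc X κ κ' (Sum.inl κ₁) (Sum.inl κ₂) + zmode Lc X κ' κ (Sum.inl κ₁) (Sum.inl κ₂) = 0))
    (hZY : (∀ κ u κ' u' t, Y κ (u + (Lc : ℤ) • t) κ' (u' + (Lc : ℤ) • t) = shiftK (-((Lc : ℤ) • t)) (Y κ u κ' u')) ∧
      (∀ κ κ' κ₁ κ₂, zmode Lc Y κ κ' (Sum.inl κ₁) (Sum.inl κ₂) + zmode Lc Y κ' κ (Sum.inl κ₁) (Sum.inl κ₂) = 0)) :
    (∀ κ u κ' u' t, (X + Y) κ (u + (Lc : ℤ) • t) κ' (u' + (Lc : ℤ) • t) = shiftK (-((Lc : ℤ) • t)) ((X + Y) κ u κ' u')) ∧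
      (∀ κ κ' κ₁ κ₂, zmode Lc (X + Y) κ κ' (Sum.inl κ₁) (Sum.inl κ₂) + zmode Lc (X + Y) κ' κ (Sum.inl κ₁) (Sum.inl κ₂) = 0) := by
  refine ⟨fun κ u κ' u' t => add_translate_pi (w := (Lc : ℤ) • t) (v := -((Lc : ℤ) • t)) (fun κ u κ' u' => hZX.1 κ u κ' u' t)
    (fun κ u κ' u' => hZY.1 κ u κ' u' t) κ u κ' u', fun κ κ' κ₁ κ₂ => ?_⟩
  have e1 : zmode Lc (X + Y) κ κ' (Sum.inl κ₁) (Sum.inl κ₂) = _ := zmode_add (N := Lc) hX hY hδ κ κ' (Sum.inl κ₁) (Sum.inl κ₂)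
  have e2 : zmode Lc (X + Y) κ' κ (Sum.inl κ₁) (Sum.inl κ₂) = _ := zmode_add (N := Lc) hX hY hδ κ' κ (Sum.inl κ₁) (Sum.inl κ₂)
  rw [e1, e2]
  have h1 := hZX.2 κ κ' κ₁ κ₂
  have h2 := hZY.2 κ κ' κ₁ κ₂
  linarith

omit [NeZero Lc] in
/-- [folklore] **THE `ZfreeSym` TEXT IS CLOSED UNDER `−`** on `LocStencil₂` tables at a common rate `δ > 0` (leaf-18's `sub_translate_pi`, leaf-19's `zmode_sub`). -/
theorem zfreeSym_sub {X Y : Tab d} {CX CY δ : ℝ} (hX : LocStencil₂ X CX δ) (hY : LocStencil₂ Y CY δ) (hδ : 0 < δ)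
    (hZX : (∀ κ u κ' u' t, X κ (u + (Lc : ℤ) • t) κ' (u' + (Lc : ℤ) • t) = shiftK (-((Lc : ℤ) • t)) (X κ u κ' u')) ∧
      (∀ κ κ' κ₁ κ₂, zmode Lc X κ κ' (Sum.inl κ₁) (Sum.inl κ₂) + zmode Lc X κ' κ (Sum.inl κ₁) (Sum.inl κ₂) = 0))
    (hZY : (∀ κ u κ' u' t, Y κ (u + (Lc : ℤ) • t) κ' (u' + (Lc : ℤ) • t) = shiftK (-((Lc : ℤ) • t)) (Y κ u κ' u')) ∧
      (∀ κ κ' κ₁ κ₂, zmode Lc Y κ κ' (Sum.inl κ₁) (Sum.inl κ₂) + zmode Lc Y κ' κ (Sum.inl κ₁) (Sum.inl κ₂) = 0)) :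
    (∀ κ u κ' u' t, (X - Y) κ (u + (Lc : ℤ) • t) κ' (u' + (Lc : ℤ) • t) = shiftK (-((Lc : ℤ) • t)) ((X - Y) κ u κ' u')) ∧
      (∀ κ κ' κ₁ κ₂, zmode Lc (X - Y) κ κ' (Sum.inl κ₁) (Sum.inl κ₂) + zmode Lc (X - Y) κ' κ (Sum.inl κ₁) (Sum.inl κ₂) = 0) := by
  refine ⟨fun κ u κ' u' t => sub_translate_pi (w := (Lc : ℤ) • t) (v := -((Lc : ℤ) • t)) (fun κ u κ' u' => hZX.1 κ u κ' u' t)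
    (fun κ u κ' u' => hZY.1 κ u κ' u' t) κ u κ' u', fun κ κ' κ₁ κ₂ => ?_⟩
  have e1 : zmode Lc (X - Y) κ κ' (Sum.inl κ₁) (Sum.inl κ₂) = _ := zmode_sub (N := Lc) hX hY hδ κ κ' (Sum.inl κ₁) (Sum.inl κ₂)
  have e2 : zmode Lc (X - Y) κ' κ (Sum.inl κ₁) (Sum.inl κ₂) = _ := zmode_sub (N := Lc) hX hY hδ κ' κ (Sum.inl κ₁) (Sum.inl κ₂)
  rw [e1, e2]
  have h1 := hZX.2 κ κ' κ₁ κ₂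
  have h2 := hZY.2 κ κ' κ₁ κ₂
  linarith

/-- [folklore] **THE TRANSPORT DIFFERENCE `(𝒜^B_i − 𝒜^B_j) X` IS `ZfreeSym` FOR EVERY JOINTLY `Lc`-COVARIANT `LocStencil₂` TABLE `X`** (`1 ≤ Lc`, rate `δ > 0`, any scalar `c`, all
steps `i j`): covariance by leaf-18's `Lin4ZeroMode.lin4_translate` (block-covariant `K♮`), BOTH index orders of the cell charge ZERO by `Lin4ZeroMode.zmode_lin4_sub_lin4_step`
(the undressed eigenfunctional is `j`-FREE) — NO pin, NO hypothesis on the charge of `X`. -/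
theorem zfreeSym_lin4_sub_lin4 (hLc : 1 ≤ Lc) (i j : ℕ) (c : ℝ) {X : Tab d} {CT δ : ℝ} (hX : LocStencil₂ X CT δ) (hδ : 0 < δ)
    (hXcov : (∀ κ u κ' u' t, X κ (u + (Lc : ℤ) • t) κ' (u' + (Lc : ℤ) • t) = shiftK (-((Lc : ℤ) • t)) (X κ u κ' u'))) :
    (∀ κ u κ' u' t, (lin4 c (unitK (sfStep Lc i) (smStep d Lc i) (KInvStep (d := d) Lc i)) Lc X - lin4 c (unitK (sfStep Lc j) (smStep d Lc j) (KInvStep (d := d) Lc j)) Lc X) κ (u + (Lc : ℤ) • t) κ' (u' + (Lc : ℤ) • t) = shiftK (-((Lc : ℤ) • t)) ((lin4 c (unitK (sfStep Lc i) (smStep d Lc i) (KInvStep (d := d) Lc i)) Lc X - lin4 c (unitK (sfStep Lc j) (smStep d Lc j) (KInvStep (d := d) Lc j)) Lc X) κ u κ' u')) ∧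
      (∀ κ κ' κ₁ κ₂, zmode Lc (lin4 c (unitK (sfStep Lc i) (smStep d Lc i) (KInvStep (d := d) Lc i)) Lc X - lin4 c (unitK (sfStep Lc j) (smStep d Lc j) (KInvStep (d := d) Lc j)) Lc X) κ κ' (Sum.inl κ₁) (Sum.inl κ₂) + zmode Lc (lin4 c (unitK (sfStep Lc i) (smStep d Lc i) (KInvStep (d := d) Lc i)) Lc X - lin4 c (unitK (sfStep Lc j) (smStep d Lc j) (KInvStep (d := d) Lc j)) Lc X) κ' κ (Sum.inl κ₁) (Sum.inl κ₂) = 0) := by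
  refine ⟨fun κ u κ' u' t => sub_translate_pi (w := (Lc : ℤ) • t) (v := -((Lc : ℤ) • t))
    (fun κ u κ' u' => lin4_translate (shiftK_unitKInvStep i) c hXcov κ u κ' u' ((Lc : ℤ) • t))
    (fun κ u κ' u' => lin4_translate (shiftK_unitKInvStep j) c hXcov κ u κ' u' ((Lc : ℤ) • t)) κ u κ' u', fun κ κ' κ₁ κ₂ => ?_⟩
  rw [zmode_lin4_sub_lin4_step hLc Lc i j c hX hδ hXcov κ κ' κ₁ κ₂, zmode_lin4_sub_lin4_step hLc Lc i j c hX hδ hXcov κ' κ κ₁ κ₂, add_zero]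

/-! ## §2 The two socket rows `hZf` and `hf` for generic tables -/

/-- NOT IN PRINT; OUR BOOKKEEPING ([folklore] §1 `zfreeSym_lin4_sub_lin4` + `zfreeSym_sub` + `zfreeSym_add`; shapes by `Lin4ZeroMode.locStencil₂_lin4` and `locStencil₂_sub`).  **THE
SOCKET's FORCING IS `ZfreeSym`**: for a jointly covariant `LocStencil₂` table `X` (the deviation `D_m`), step kernels `K♮_i, K♮_j` decaying at one `(CK, mK)`, and two `LocStencil₂`
tables `G, G′` (the forcings `g_m, g_{m+1}`) carrying the `ZfreeSym` text, the table `(𝒜^B_i X − 𝒜^B_j X) + (G′ − G)` carries it — the `hZf` row of the OWNER's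
`T2DeviationDrift.drift_of_dev_rows` at `A := 𝒜^B`, with NO hypothesis on the charge of `X`. -/
theorem zfreeSym_forcing (hLc : 1 ≤ Lc) (i j : ℕ) (c : ℝ) {X G G' : Tab d} {CK mK CT δ CG CG' δG : ℝ}
    (hKi : Decays (unitK (sfStep Lc i) (smStep d Lc i) (KInvStep (d := d) Lc i)) CK mK) (hKj : Decays (unitK (sfStep Lc j) (smStep d Lc j) (KInvStep (d := d) Lc j)) CK mK) (hCK : 0 ≤ CK) (hmK : 0 < mK)
    (hX : LocStencil₂ X CT δ) (hδ : 0 < δ)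
    (hXcov : (∀ κ u κ' u' t, X κ (u + (Lc : ℤ) • t) κ' (u' + (Lc : ℤ) • t) = shiftK (-((Lc : ℤ) • t)) (X κ u κ' u')))
    (hG : LocStencil₂ G CG δG) (hG' : LocStencil₂ G' CG' δG) (hδG : 0 < δG)
    (hZG : (∀ κ u κ' u' t, G κ (u + (Lc : ℤ) • t) κ' (u' + (Lc : ℤ) • t) = shiftK (-((Lc : ℤ) • t)) (G κ u κ' u')) ∧
      (∀ κ κ' κ₁ κ₂, zmode Lc G κ κ' (Sum.inl κ₁) (Sum.inl κ₂) + zmode Lc G κ' κ (Sum.inl κ₁) (Sum.inl κ₂) = 0))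
    (hZG' : (∀ κ u κ' u' t, G' κ (u + (Lc : ℤ) • t) κ' (u' + (Lc : ℤ) • t) = shiftK (-((Lc : ℤ) • t)) (G' κ u κ' u')) ∧
      (∀ κ κ' κ₁ κ₂, zmode Lc G' κ κ' (Sum.inl κ₁) (Sum.inl κ₂) + zmode Lc G' κ' κ (Sum.inl κ₁) (Sum.inl κ₂) = 0)) :
    (∀ κ u κ' u' t, ((lin4 c (unitK (sfStep Lc i) (smStep d Lc i) (KInvStep (d := d) Lc i)) Lc X - lin4 c (unitK (sfStep Lc j) (smStep d Lc j) (KInvStep (d := d) Lc j)) Lc X) + (G' - G)) κ (u + (Lc : ℤ) • t) κ' (u' + (Lc : ℤ) • t) = shiftK (-((Lc : ℤ) • t)) (((lin4 c (unitK (sfStep Lc i) (smStep d Lc i) (KInvStep (d := d) Lc i)) Lc X - lin4 c (unitK (sfStep Lc j) (smStep d Lc j) (KInvStep (d := d) Lc j)) Lc X) + (G' - G)) κ u κ' u')) ∧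
      (∀ κ κ' κ₁ κ₂, zmode Lc ((lin4 c (unitK (sfStep Lc i) (smStep d Lc i) (KInvStep (d := d) Lc i)) Lc X - lin4 c (unitK (sfStep Lc j) (smStep d Lc j) (KInvStep (d := d) Lc j)) Lc X) + (G' - G)) κ κ' (Sum.inl κ₁) (Sum.inl κ₂) + zmode Lc ((lin4 c (unitK (sfStep Lc i) (smStep d Lc i) (KInvStep (d := d) Lc i)) Lc X - lin4 c (unitK (sfStep Lc j) (smStep d Lc j) (KInvStep (d := d) Lc j)) Lc X) + (G' - G)) κ' κ (Sum.inl κ₁) (Sum.inl κ₂) = 0) := by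
  have hP : LocStencil₂ (lin4 c (unitK (sfStep Lc i) (smStep d Lc i) (KInvStep (d := d) Lc i)) Lc X - lin4 c (unitK (sfStep Lc j) (smStep d Lc j) (KInvStep (d := d) Lc j)) Lc X) _ (min mK δ / 128) :=
    locStencil₂_sub (locStencil₂_lin4 hKi hCK hmK hLc c hX hδ) (locStencil₂_lin4 hKj hCK hmK hLc c hX hδ)
  have hR : LocStencil₂ (G' - G) _ δG := locStencil₂_sub hG' hG
  have hz : 0 < min (min mK δ / 128) δG := lt_min (by positivity) hδG
  exact zfreeSym_add (hP.mono (min_le_left _ _)) (hR.mono (min_le_right _ _)) hz (zfreeSym_lin4_sub_lin4 hLc i j c hX hδ hXcov)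
    (zfreeSym_sub hG' hG hδG hZG' hZG)

/-- NOT IN PRINT; OUR BOOKKEEPING ([folklore] leaf-03's `TransportStepLipschitz.lin_cauchy` (`k := m`, `j := 1`) on a uniformly shaped family `X_m` + a RATE row of `G`, merged at
`θf := max θK θG`, `δf := min (m₀∕128) δG`, `m₀ := min δK δX`; twin of leaf-04's `T2UndressedCombDriftRows.hf_of_shapes` with the source Cauchy row replaced by an abstract `G`).
**THE SOCKET's FORCING RATE ROW**: if `K♮_j` decays uniformly (`CK, δK`) with the Cauchy row `Decays (K♮_{k+j} − K♮_k) (cK·θK^k) δK` (`0 ≤ θK < 1`; road P1's `convCKWall_holds` at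
`d = 3`), `X_m` is uniformly `LocStencil₂ CX δX`, and `LocStencil₂ (G_{m+1} − G_m) (CG′·θG^m) δG` (`0 ≤ θG < 1`), then
`∃ Cf θf δf, 0 ≤ Cf ∧ 0 ≤ θf ∧ θf < 1 ∧ 0 < δf ∧ ∀ m, LocStencil₂ ((𝒜^B_{m+1} X_m − 𝒜^B_m X_m) + (G_{m+1} − G_m)) (Cf·θf^m) δf` — the `hf` row of the OWNER's socket at `A := 𝒜^B`. -/
theorem exists_forcing_rate (hLc : 1 ≤ Lc) (c : ℝ) (X G : ℕ → Tab d) {CK δK cK θK CX δX CG' θG δG : ℝ}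
    (hK : ∀ j : ℕ, Decays (unitK (sfStep Lc j) (smStep d Lc j) (KInvStep (d := d) Lc j)) CK δK)
    (hKc : ∀ k j : ℕ, Decays ((unitK (sfStep Lc (k + j)) (smStep d Lc (k + j)) (KInvStep (d := d) Lc (k + j))) - (unitK (sfStep Lc k) (smStep d Lc k) (KInvStep (d := d) Lc k))) (cK * θK ^ k) δK)
    (hδK : 0 < δK) (hθK0 : 0 ≤ θK) (hθK1 : θK < 1)
    (hX : ∀ m : ℕ, LocStencil₂ (X m) CX δX) (hδX : 0 < δX)
    (hGr : ∀ m : ℕ, LocStencil₂ (G (m + 1) - G m) (CG' * θG ^ m) δG) (hθG0 : 0 ≤ θG) (hθG1 : θG < 1) (hδG : 0 < δG) :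
    ∃ Cf θf δf : ℝ, 0 ≤ Cf ∧ 0 ≤ θf ∧ θf < 1 ∧ 0 < δf ∧
      ∀ m : ℕ, LocStencil₂ ((lin4 c (unitK (sfStep Lc (m + 1)) (smStep d Lc (m + 1)) (KInvStep (d := d) Lc (m + 1))) Lc (X m) - lin4 c (unitK (sfStep Lc m) (smStep d Lc m) (KInvStep (d := d) Lc m)) Lc (X m)) + (G (m + 1) - G m)) (Cf * θf ^ m) δf := by
  have hCK : 0 ≤ CK := (hK 0).nonneg (Sum.inl 0)
  have hcK : 0 ≤ cK := by have h := (hKc 0 0).nonneg (Sum.inl 0); simpa using h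
  have hCX : 0 ≤ CX := (hX 0).nonneg
  have hCG' : 0 ≤ CG' := by have h := (hGr 0).nonneg; simpa using h
  obtain ⟨m₀, hm₀_def⟩ : ∃ m₀ : ℝ, m₀ = min δK δX := ⟨_, rfl⟩
  have hm₀ : 0 < m₀ := by rw [hm₀_def]; exact lt_min hδK hδX
  have hK1 : ∀ j, Decays (unitK (sfStep Lc j) (smStep d Lc j) (KInvStep (d := d) Lc j)) CK m₀ :=
    fun j => decays_mono (hK j) hCK le_rfl (by rw [hm₀_def]; exact min_le_left _ _)
  have hKc1 : ∀ k j, Decays ((unitK (sfStep Lc (k + j)) (smStep d Lc (k + j)) (KInvStep (d := d) Lc (k + j))) - (unitK (sfStep Lc k) (smStep d Lc k) (KInvStep (d := d) Lc k))) (cK * θK ^ k) m₀ :=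
    fun k j => decays_mono (hKc k j) (by positivity) le_rfl (by rw [hm₀_def]; exact min_le_left _ _)
  have hX₀ : ∀ m, LocStencil₂ (X m) CX m₀ := fun m => (hX m).mono (by rw [hm₀_def]; exact min_le_right _ _)
  obtain ⟨L₁, hL₁_def⟩ : ∃ L₁ : ℝ, L₁ = |c| * lSand d CK (cBi d CK CX m₀) cK (lBi d CK CX cK 0 m₀) (m₀ / 32) := ⟨_, rfl⟩
  have h1 : ∀ m : ℕ, LocStencil₂ (lin4 c (unitK (sfStep Lc (m + 1)) (smStep d Lc (m + 1)) (KInvStep (d := d) Lc (m + 1))) Lc (X m) - lin4 c (unitK (sfStep Lc m) (smStep d Lc m) (KInvStep (d := d) Lc m)) Lc (X m)) (L₁ * θK ^ m) (m₀ / 128) := fun m => by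
    rw [hL₁_def]
    exact lin_cauchy (Lc := Lc) (K := fun j => (unitK (sfStep Lc j) (smStep d Lc j) (KInvStep (d := d) Lc j))) hLc hm₀ hK1 hKc1 (hX₀ m) c m 1
  have hL₁ : 0 ≤ L₁ := by have h := (h1 0).nonneg; simpa using h
  refine ⟨L₁ + CG', max θK θG, min (m₀ / 128) δG, by positivity, hθK0.trans (le_max_left _ _), max_lt hθK1 hθG1,
    lt_min (by positivity) hδG, fun m => ?_⟩
  have h1' := locStencil₂_le_mono (h1 m) (mul_pow_le_mul_pow hL₁ hθK0 (le_max_left θK θG) m) (min_le_left _ _ : min (m₀ / 128) δG ≤ m₀ / 128)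
  have h2' := locStencil₂_le_mono (hGr m) (mul_pow_le_mul_pow hCG' hθG0 (le_max_right θK θG) m) (min_le_right _ _ : min (m₀ / 128) δG ≤ δG)
  have h := locStencil₂_add h1' h2'
  rw [← add_mul] at h
  exact h

end Generic

end Summit.QuantumFields.BalabanUV.Beta.GAN24.T2DevConservationDriftRows

end
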